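import Mathlib.LinearAlgebra.FiniteDimensional.Basic
import Literature.Probability.LatticeModels.EffectiveResistanceProofs
import HarnessLib

/-!
# The unit current flow of a finite network (Kirchhoff flow; Tetali's potential formula)

For a network `(G, c)` (a simple graph `G : SimpleGraph V` with conductances `c : Sym2 V → ℝ≥0`,
as in `EffectiveResistance.lean`) and two vertices `a b : V`, the **unit current flow** from `a`
to `b` is the antisymmetric edge function `i(v, w) = c(vw) [φ(v) - φ(w)]` (Ohm's law), where the
*voltage* `φ` is harmonic off `{a, b}` and normalised so that the total current out of `a` is `1`
(Lyons–Peres 2016, §2.1–§2.2 and §2.4; Grimmett 2018, §1.1–§1.3). It satisfies Kirchhoff's node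
law `Σ_w i(v, w) = 1[v = a] - 1[v = b]`, and by (2.5)/(2.7) of Lyons–Peres the voltage drop is
`φ(a) - φ(b) = ℛ(a ↔ b)`.

Following the definition request, the flow is *defined* here without any choice, through
**Tetali's formula** for the voltage (Tetali 1991; Lyons–Peres 2016, Exercise 2.68 and
Exercise 2.62 (b), (d)): grounding at `b`,

  `φ(z) = (ℛ(a ↔ b) + ℛ(z ↔ b) - ℛ(z ↔ a)) / 2`,   `unitPotential G c a b z`,

with `ℛ(x ↔ y) = (effectiveResistance G c {x} {y}).toReal` (`pointResistance`; it is `0` on the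
diagonal and, by the `ℝ≥0∞` conventions of `EffectiveResistance.lean`, `0 = (⊤).toReal` when `x`
and `y` are not joined by a path of positive conductance), and then

  `unitCurrentFlow G c a b v w = 1[vw ∈ E(G)] · c(vw) · [φ(v) - φ(w)]`
  `  = 1[vw ∈ E(G)] · c(vw) · [(ℛ(v ↔ b) - ℛ(v ↔ a)) - (ℛ(w ↔ b) - ℛ(w ↔ a))] / 2`.

Conductances may vanish on edges (this is how subnetworks of a fixed graph are encoded, e.g. the
odd bonds of a current on a torus), so the relevant notion of component is *electrical*: the
connected components of `conductanceGraph G c`, the subgraph of `G` of the edges of positive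
conductance (`effectiveResistance_ne_top_iff`: `ℛ(x ↔ y) < ⊤` iff `x, y` lie in one of them).

Proved here, for a finite vertex type where sums over vertices occur:

* unfolding, antisymmetry `i(w, v) = -i(v, w)`, pole reversal `i_{ba} = -i_{ab}`, `i = 0` off
  `E(G)`, on zero-conductance pairs and at every vertex joined by positive conductances to neither
  pole (`unitCurrentFlow_eq_zero_of_not_reachable`; in particular off the electrical component of
  `a` when `a` and `b` are joined);
* **existence of the voltage** (`exists_networkLaplacian_eq`): if `a` and `b` are joined by a path
  of positive conductance there is `φ : V → ℝ` with weighted Laplacian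
  `Σ_{w ~ z} c(zw) (φ(z) - φ(w)) = 1[z = a] - 1[z = b]` for all `z` (finite-dimensional linear
  algebra: the grounded Laplacian is injective by the energy identity, hence surjective —
  Lyons–Peres 2016, §2.1, existence and uniqueness of harmonic extensions);
* `ℛ(a ↔ b) = φ(a) - φ(b)` for every such `φ` (`pointResistance_eq_of_networkLaplacian`;
  Lyons–Peres (2.5), Grimmett (1.23)–(1.24)), the **reciprocity law** / symmetry of the grounded
  Green kernel (`green_reciprocity`; Lyons–Peres Exercise 2.62 (b)), and hence **Tetali's
  formula** `unitPotential G c a b z = φ(z) - φ(b)` on the electrical component of `b`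
  (`unitPotential_eq_of_networkLaplacian`; Lyons–Peres Exercise 2.68);
* **Kirchhoff's node law** for `unitCurrentFlow` at *every* vertex (`sum_unitCurrentFlow`:
  `Σ_w i(v, w) = 1[v = a] - 1[v = b]` whenever `a, b` are joined by positive conductances;
  corollaries for `ℛ(a ↔ b) ≠ ⊤` and for connected graphs with positive conductances);
* the bound `|i(v, w)| ≤ 1` (`abs_unitCurrentFlow_le_one`: a current is acyclic, so the flow
  through an edge is at most the unit flow through the cut `{φ > φ(w)}`);
* the energy identity `Σ_{v,w} i(v, w)² / c(vw) = 2 ℛ(a ↔ b)` (`sum_unitCurrentFlow_sq_div`;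
  Lyons–Peres (2.7), Grimmett Lemma 1.25) and **Thomson's principle** with uniqueness
  (`sum_sq_div_eq_add`: `Σ θ²/c = Σ i²/c + Σ (θ - i)²/c` for every unit flow `θ` from `a` to `b`
  supported on the positive-conductance edges — Lyons–Peres (2.10); `sum_unitCurrentFlow_sq_div_le`,
  `eq_unitCurrentFlow_of_sum_sq_div_le` — Lyons–Peres §2.4, Grimmett Theorem 1.28);
* **Kirchhoff's theorem** in spanning-tree form (`unitCurrentFlow_mul_treeSum`,
  `unitCurrentFlow_eq_treeSum_div`; Kirchhoff 1847, Grimmett 2018 Theorem 1.16 with (1.18),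
  Lyons–Peres 2016 §4.2): on a finite connected network with positive conductances,
  `i(v, w) · Σ_T wt(T) = Σ_T wt(T) (1[T ∈ 𝒩(a, v, w, b)] - 1[T ∈ 𝒩(a, w, v, b)])` over the
  spanning trees `T`, `wt(T) = Π_{f ∈ T} c(f)`, where `T ∈ 𝒩(a, v, w, b)` means that the `a`–`b`
  path of `T` traverses `vw` from `v` to `w` (equivalently: `vw ∈ T` and `T - vw` has `a, v` on
  one side and `b, w` on the other) — i.e. `i(v, w) = E[net number of signed traversals of vw by
  the path from a to b in the weighted uniform spanning tree]`. This reuses the 2-forest potential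
  and the bush–tree correspondence of `EffectiveResistanceProofs.lean`.

Not here: the probabilistic interpretations (Propositions 2.1–2.2 of Lyons–Peres: voltage as
Green function, current as expected edge crossings), Kirchhoff's cycle law as a separate statement
(the flow is a gradient by definition), infinite networks.

## References

* [LyonsPeres2016] R. Lyons, Y. Peres, *Probability on Trees and Networks*, CUP 2016: §2.1
  (voltage, current `i(x, y) = c(x, y)[v(x) - v(y)]`, flows, Kirchhoff's node and cycle laws;
  PDF p. 91 of the held copy), §2.2 (effective conductance and resistance, (2.3)–(2.5)), §2.4
  (`d`, `d*`, Lemma 2.8, energy, (2.7) `ℰ(i) = ℛ(a ↔ z)`, Thomson's principle, reciprocity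
  (2.12)), §2.7 Proposition 2.20 (Tetali 1991), Chapter 2 Additional Exercises 2.62 (network
  Laplacian, Green kernel `v_a(x, y) = v_a(y, x)`, `ℛ(x ↔ y) = v_a(x,x) - 2 v_a(x,y) + v_a(y,y)`)
  and 2.68 (`P_x[τ_z < τ_a] = [ℛ(a↔x) - ℛ(x↔z) + ℛ(a↔z)] / 2ℛ(a↔z)`), §4.2 (Kirchhoff's
  effective resistance formula).
* [Grimmett2018] G. Grimmett, *Probability on Graphs*, 2nd ed., CUP 2018, §1.1–§1.3:
  Definition 1.14 (`s/t` flow, unit flow), Theorem 1.15 (uniqueness), Theorem 1.16 and (1.18)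
  (Kirchhoff: the spanning-tree formula is the unit current flow), Proposition 1.21,
  (1.22)–(1.24), Lemma 1.25, Theorem 1.28 (Thomson principle).
* [Tetali1991] P. Tetali, *Random walks and the effective resistance of networks*, J. Theoret.
  Probab. 4 (1991) 101–109, doi:10.1007/BF01046996 (the hitting-time identity through the
  voltage formula above).
-/

namespace Literature.Probability.LatticeModels

open scoped ENNReal NNReal
open SimpleGraph Finset

noncomputable section

variable {V : Type*}

/-! ### The positive-conductance subgraph; finiteness of point-to-point resistances -/

/-- The subgraph of `G` consisting of the edges of positive conductance. Its connected components
are the *electrical components* of the network `(G, c)`: zero-conductance edges carry no current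
and no energy. [folklore] -/
def conductanceGraph (G : SimpleGraph V) (c : Sym2 V → ℝ≥0) : SimpleGraph V where
  Adj x y := G.Adj x y ∧ 0 < c s(x, y)
  symm := ⟨fun _ _ h ↦ ⟨h.1.symm, by rw [Sym2.eq_swap]; exact h.2⟩⟩
  loopless := ⟨fun _ h ↦ G.irrefl h.1⟩

section ConductanceGraph

variable {G : SimpleGraph V} {c : Sym2 V → ℝ≥0} {x y : V}

/-- Unfolding lemma. [folklore] -/
@[simp] theorem conductanceGraph_adj :
    (conductanceGraph G c).Adj x y ↔ G.Adj x y ∧ 0 < c s(x, y) := Iff.rfl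

/-- `conductanceGraph G c` is a spanning subgraph of `G`. [folklore] -/
theorem conductanceGraph_le (G : SimpleGraph V) (c : Sym2 V → ℝ≥0) : conductanceGraph G c ≤ G :=
  fun _ _ h ↦ h.1

/-- With positive conductances on all edges, `conductanceGraph G c = G`. [folklore] -/
theorem conductanceGraph_eq_of_pos (h : ∀ e ∈ G.edgeSet, 0 < c e) : conductanceGraph G c = G :=
  le_antisymm (conductanceGraph_le G c) fun _ _ hxy ↦ ⟨hxy, h _ ((mem_edgeSet G).2 hxy)⟩

/-- A conductance that is not positive is zero. [folklore] -/
theorem conductance_eq_zero_of_not_pos {e : Sym2 V} (h : ¬ 0 < c e) : c e = 0 :=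
  nonpos_iff_eq_zero.1 (not_lt.1 h)

/-- Zero-conductance edges carry no energy: the energy of a potential is the same on `G` and on
its positive-conductance subgraph. [folklore] -/
theorem networkEnergy_conductanceGraph (G : SimpleGraph V) (c : Sym2 V → ℝ≥0) (v : V → ℝ) :
    networkEnergy (conductanceGraph G c) c v = networkEnergy G c v := by
  unfold networkEnergy
  refine tsum_congr fun e ↦ ?_
  induction e with
  | h x y =>
    by_cases hG : G.Adj x y
    · by_cases hc : 0 < c s(x, y)
      · rw [Set.indicator_of_mem ((mem_edgeSet (conductanceGraph G c)).2 ⟨hG, hc⟩),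
          Set.indicator_of_mem ((mem_edgeSet G).2 hG)]
      · rw [Set.indicator_of_mem ((mem_edgeSet G).2 hG),
          Set.indicator_of_notMem (fun h ↦ hc ((mem_edgeSet (conductanceGraph G c)).1 h).2),
          conductance_eq_zero_of_not_pos hc, ENNReal.coe_zero, zero_mul]
    · rw [Set.indicator_of_notMem (fun h ↦ hG ((mem_edgeSet G).1 h)),
        Set.indicator_of_notMem (fun h ↦ hG ((mem_edgeSet (conductanceGraph G c)).1 h).1)]

/-- The effective conductance only sees the positive-conductance subgraph. [folklore] -/
theorem effectiveConductance_conductanceGraph (G : SimpleGraph V) (c : Sym2 V → ℝ≥0)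
    (A Z : Set V) :
    effectiveConductance (conductanceGraph G c) c A Z = effectiveConductance G c A Z := by
  simp only [effectiveConductance, networkEnergy_conductanceGraph]

/-- The effective resistance only sees the positive-conductance subgraph. [folklore] -/
theorem effectiveResistance_conductanceGraph (G : SimpleGraph V) (c : Sym2 V → ℝ≥0)
    (A Z : Set V) :
    effectiveResistance (conductanceGraph G c) c A Z = effectiveResistance G c A Z := by
  rw [effectiveResistance_def, effectiveResistance_def, effectiveConductance_conductanceGraph]

/-- `ℛ(x ↔ y) = ⊤` when `y` cannot be reached from `x` through edges of positive conductance.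
[folklore] -/
theorem effectiveResistance_eq_top_of_not_reachable_conductanceGraph
    (h : ¬ (conductanceGraph G c).Reachable x y) : effectiveResistance G c {x} {y} = ⊤ := by
  rw [← effectiveResistance_conductanceGraph]
  exact effectiveResistance_eq_top_of_not_reachable fun a ha z hz ↦ by
    rw [Set.mem_singleton_iff.1 ha, Set.mem_singleton_iff.1 hz]
    exact h

/-- `ℛ(x ↔ y) < ⊤` when `x` and `y` are joined by a path of positive conductance (the series
upper bound `effectiveResistance_le_sum_inv` along a path). [folklore] -/
theorem effectiveResistance_ne_top_of_reachable (h : (conductanceGraph G c).Reachable x y) :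
    effectiveResistance G c {x} {y} ≠ ⊤ := by
  classical
  obtain ⟨p⟩ := h
  have hq : ∀ e ∈ p.bypass.edges, e ∈ G.edgeSet := fun e he ↦
    edgeSet_mono (conductanceGraph_le G c) (p.bypass.edges_subset_edgeSet he)
  have hpos : ∀ e ∈ (p.bypass.transfer G hq).edges, 0 < c e := by
    rw [Walk.edges_transfer]
    intro e he
    have h' := p.bypass.edges_subset_edgeSet he
    revert h'
    refine Sym2.ind (fun a b hab ↦ ?_) e
    exact ((mem_edgeSet (conductanceGraph G c)).1 hab).2
  have hle := effectiveResistance_le_sum_inv (A := ({x} : Set V)) (Z := ({y} : Set V)) (c := c)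
    (Set.mem_singleton x) (Set.mem_singleton y) (p.bypass.transfer G hq)
    (by rw [Walk.edges_transfer]; exact p.bypass_isPath.isTrail.edges_nodup) hpos
  refine ne_top_of_le_ne_top (ENNReal.sum_ne_top.2 fun e he ↦ ?_) hle
  exact ENNReal.inv_ne_top.2 (ENNReal.coe_ne_zero.2 (hpos e (List.mem_toFinset.1 he)).ne')

/-- `ℛ(x ↔ y)` is finite iff `x` and `y` are joined by a path of positive conductance (in
particular `ℛ(x ↔ x) = 0 < ⊤`). [folklore] -/
theorem effectiveResistance_ne_top_iff :
    effectiveResistance G c {x} {y} ≠ ⊤ ↔ (conductanceGraph G c).Reachable x y :=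
  ⟨fun h ↦ by_contra fun h' ↦ h (effectiveResistance_eq_top_of_not_reachable_conductanceGraph h'),
    effectiveResistance_ne_top_of_reachable⟩

/-- A walk of `G` all of whose edges have positive conductance joins its endpoints in
`conductanceGraph G c` ("joined by a path of positive conductance"). [folklore] -/
theorem conductanceGraph_reachable_of_walk {a b : V} (p : G.Walk a b)
    (hp : ∀ e ∈ p.edges, 0 < c e) : (conductanceGraph G c).Reachable a b := by
  induction p with
  | nil => exact Reachable.refl _
  | @cons u v w h q ih =>
    have huv : (conductanceGraph G c).Adj u v := ⟨h, hp _ (by simp)⟩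
    exact huv.reachable.trans (ih fun e he ↦ hp e (by simp [he]))

end ConductanceGraph

/-! ### Point-to-point resistance as a real number -/

/-- The effective resistance `ℛ(x ↔ y)` between two vertices, as a real number:
`(effectiveResistance G c {x} {y}).toReal`. It is `0` for `x = y` and (junk value `(⊤).toReal`)
`0` when `x, y` are not joined by a path of positive conductance; otherwise it is the genuine
(finite, nonnegative) effective resistance of Lyons–Peres 2016, §2.2.
[cite: LyonsPeres2016, §2.2, eq. (2.4)–(2.5)] -/
def pointResistance (G : SimpleGraph V) (c : Sym2 V → ℝ≥0) (x y : V) : ℝ :=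
  (effectiveResistance G c {x} {y}).toReal

section PointResistance

variable {G : SimpleGraph V} {c : Sym2 V → ℝ≥0} {x y : V}

/-- Unfolding lemma. [folklore] -/
theorem pointResistance_def (G : SimpleGraph V) (c : Sym2 V → ℝ≥0) (x y : V) :
    pointResistance G c x y = (effectiveResistance G c {x} {y}).toReal := rfl

/-- `ℛ(x ↔ y) ≥ 0`. [folklore] -/
theorem pointResistance_nonneg (G : SimpleGraph V) (c : Sym2 V → ℝ≥0) (x y : V) :
    0 ≤ pointResistance G c x y := ENNReal.toReal_nonneg

/-- Symmetry `ℛ(x ↔ y) = ℛ(y ↔ x)`. [folklore] -/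
theorem pointResistance_comm (G : SimpleGraph V) (c : Sym2 V → ℝ≥0) (x y : V) :
    pointResistance G c x y = pointResistance G c y x := by
  rw [pointResistance, pointResistance, effectiveResistance_comm]

/-- `ℛ(x ↔ x) = 0`. [folklore] -/
@[simp] theorem pointResistance_self (G : SimpleGraph V) (c : Sym2 V → ℝ≥0) (x : V) :
    pointResistance G c x x = 0 := by
  rw [pointResistance, effectiveResistance_of_not_disjoint, ENNReal.toReal_zero]
  exact Set.not_disjoint_iff.2 ⟨x, rfl, rfl⟩

/-- The junk value: `ℛ(x ↔ y) = (⊤).toReal = 0` when `x, y` are not joined by a path of positive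
conductance. [folklore] -/
theorem pointResistance_of_not_reachable (h : ¬ (conductanceGraph G c).Reachable x y) :
    pointResistance G c x y = 0 := by
  rw [pointResistance, effectiveResistance_eq_top_of_not_reachable_conductanceGraph h,
    ENNReal.toReal_top]

end PointResistance

/-! ### Tetali's potential and the unit current flow -/

/-- **Tetali's formula** for the voltage at `z` when a unit current flows from `a` to `b` in the
network `(G, c)`, grounded at `b`: `φ(z) = (ℛ(a ↔ b) + ℛ(z ↔ b) - ℛ(z ↔ a)) / 2`
(Lyons–Peres 2016, Exercise 2.68, in the form `P_z[τ_a < τ_b] = φ(z) / ℛ(a ↔ b)`; equivalently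
Exercise 2.62 (b), (d): the grounded Green kernel is symmetric and
`ℛ(z ↔ a) = v_b(z,z) - 2 v_b(z,a) + v_b(a,a)`; Tetali 1991). Taken here as the *definition* of
the voltage; that it is the voltage is `unitPotential_eq_of_networkLaplacian`.
[cite: LyonsPeres2016, Chapter 2, Additional Exercises, Exercise 2.68] -/
def unitPotential (G : SimpleGraph V) (c : Sym2 V → ℝ≥0) (a b z : V) : ℝ :=
  (pointResistance G c a b + pointResistance G c z b - pointResistance G c z a) / 2

/-- The **unit current flow** from `a` to `b` in the network `(G, c)` (Lyons–Peres 2016, §2.1: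
`i(x, y) := c(x, y)[v(x) - v(y)]` for the voltage `v` of the unit current; Grimmett 2018,
Definition 1.14 and Theorem 1.16), as a function of ordered pairs of vertices: on an edge `vw` of
`G` it is `c(vw) [φ(v) - φ(w)]` with `φ = unitPotential G c a b` (Tetali's formula), i.e.
`c(vw) [(ℛ(v ↔ b) - ℛ(v ↔ a)) - (ℛ(w ↔ b) - ℛ(w ↔ a))] / 2`, and it is `0` on non-adjacent pairs.
Meaningful when `a` and `b` are joined by a path of positive conductance (then it is the unit
current: `sum_unitCurrentFlow`); for `a = b` it vanishes identically.
[cite: LyonsPeres2016, §2.1, definition of the current, Ohm's law and Kirchhoff's node law] -/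
def unitCurrentFlow (G : SimpleGraph V) (c : Sym2 V → ℝ≥0) (a b v w : V) : ℝ :=
  G.edgeSet.indicator (fun e ↦ (c e : ℝ)) s(v, w) * (unitPotential G c a b v - unitPotential G c a b w)

section Basic

variable {G : SimpleGraph V} {c : Sym2 V → ℝ≥0} {a b v w : V}

/-- Unfolding lemma. [folklore] -/
theorem unitPotential_def (G : SimpleGraph V) (c : Sym2 V → ℝ≥0) (a b z : V) :
    unitPotential G c a b z =
      (pointResistance G c a b + pointResistance G c z b - pointResistance G c z a) / 2 := rfl

/-- The voltage at the source is `ℛ(a ↔ b)`. [cite: LyonsPeres2016, §2.2, eq. (2.5)] -/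
@[simp] theorem unitPotential_source (G : SimpleGraph V) (c : Sym2 V → ℝ≥0) (a b : V) :
    unitPotential G c a b a = pointResistance G c a b := by
  rw [unitPotential, pointResistance_self]
  ring

/-- The voltage at the sink is `0` (grounding). [folklore] -/
@[simp] theorem unitPotential_sink (G : SimpleGraph V) (c : Sym2 V → ℝ≥0) (a b : V) :
    unitPotential G c a b b = 0 := by
  rw [unitPotential, pointResistance_self, pointResistance_comm G c b a]
  ring

/-- Voltage differences in terms of resistances (the bracket in the definition of the flow).
[folklore] -/
theorem unitPotential_sub (G : SimpleGraph V) (c : Sym2 V → ℝ≥0) (a b v w : V) :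
    unitPotential G c a b v - unitPotential G c a b w =
      ((pointResistance G c v b - pointResistance G c v a) -
        (pointResistance G c w b - pointResistance G c w a)) / 2 := by
  simp only [unitPotential]
  ring

/-- Unfolding lemma, fully spelled out: `i(v, w) = 1[vw ∈ E(G)] c(vw) ·
[(ℛ(v↔b) - ℛ(v↔a)) - (ℛ(w↔b) - ℛ(w↔a))] / 2` with `ℛ = (effectiveResistance G c {·} {·}).toReal`.
[folklore] -/
theorem unitCurrentFlow_apply (G : SimpleGraph V) (c : Sym2 V → ℝ≥0) (a b v w : V) :
    unitCurrentFlow G c a b v w =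
      G.edgeSet.indicator (fun e ↦ (c e : ℝ)) s(v, w) *
        ((((effectiveResistance G c {v} {b}).toReal - (effectiveResistance G c {v} {a}).toReal) -
          ((effectiveResistance G c {w} {b}).toReal - (effectiveResistance G c {w} {a}).toReal)) /
            2) := by
  rw [unitCurrentFlow, unitPotential_sub]
  rfl

/-- On an edge of `G`: `i(v, w) = c(vw) [(ℛ(v↔b) - ℛ(v↔a)) - (ℛ(w↔b) - ℛ(w↔a))] / 2`.
[folklore] -/
theorem unitCurrentFlow_of_adj (h : G.Adj v w) :
    unitCurrentFlow G c a b v w = (c s(v, w) : ℝ) *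
      (((pointResistance G c v b - pointResistance G c v a) -
        (pointResistance G c w b - pointResistance G c w a)) / 2) := by
  rw [unitCurrentFlow, unitPotential_sub, Set.indicator_of_mem ((mem_edgeSet G).2 h)]

/-- On an edge of `G`, Ohm's law: `i(v, w) = c(vw) [φ(v) - φ(w)]`.
[cite: LyonsPeres2016, §2.1, Ohm's Law] -/
theorem unitCurrentFlow_of_adj' (h : G.Adj v w) :
    unitCurrentFlow G c a b v w =
      (c s(v, w) : ℝ) * (unitPotential G c a b v - unitPotential G c a b w) := by
  rw [unitCurrentFlow, Set.indicator_of_mem ((mem_edgeSet G).2 h)]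

/-- The flow vanishes on non-adjacent pairs (in particular on the diagonal).
[cite: Grimmett2018, §1.1, Definition 1.14 (b)] -/
theorem unitCurrentFlow_of_not_adj (h : ¬ G.Adj v w) : unitCurrentFlow G c a b v w = 0 := by
  rw [unitCurrentFlow, Set.indicator_of_notMem (fun h' ↦ h ((mem_edgeSet G).1 h')), zero_mul]

/-- Unfolding lemma with a decidable adjacency. [folklore] -/
theorem unitCurrentFlow_eq_ite [DecidableRel G.Adj] (a b v w : V) :
    unitCurrentFlow G c a b v w = if G.Adj v w then (c s(v, w) : ℝ) *
      (((pointResistance G c v b - pointResistance G c v a) -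
        (pointResistance G c w b - pointResistance G c w a)) / 2) else 0 := by
  split_ifs with h
  · exact unitCurrentFlow_of_adj h
  · exact unitCurrentFlow_of_not_adj h

/-- `i(v, v) = 0`. [folklore] -/
@[simp] theorem unitCurrentFlow_self (G : SimpleGraph V) (c : Sym2 V → ℝ≥0) (a b v : V) :
    unitCurrentFlow G c a b v v = 0 :=
  unitCurrentFlow_of_not_adj G.irrefl

/-- Zero-conductance pairs carry no current. [folklore] -/
theorem unitCurrentFlow_of_conductance_eq_zero (h : c s(v, w) = 0) :
    unitCurrentFlow G c a b v w = 0 := by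
  by_cases hadj : G.Adj v w
  · rw [unitCurrentFlow_of_adj' hadj, h, NNReal.coe_zero, zero_mul]
  · exact unitCurrentFlow_of_not_adj hadj

/-- The flow is supported on the edges of positive conductance. [folklore] -/
theorem unitCurrentFlow_of_not_conductanceGraph_adj (h : ¬ (conductanceGraph G c).Adj v w) :
    unitCurrentFlow G c a b v w = 0 := by
  by_cases hadj : G.Adj v w
  · exact unitCurrentFlow_of_conductance_eq_zero
      (conductance_eq_zero_of_not_pos fun hc ↦ h ⟨hadj, hc⟩)
  · exact unitCurrentFlow_of_not_adj hadj

/-- **Antisymmetry** `i(w, v) = -i(v, w)`. [cite: LyonsPeres2016, §2.1, "Notice that i(x, y) = -i(y, x)"] -/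
theorem unitCurrentFlow_anti (G : SimpleGraph V) (c : Sym2 V → ℝ≥0) (a b v w : V) :
    unitCurrentFlow G c a b w v = -unitCurrentFlow G c a b v w := by
  rw [unitCurrentFlow, unitCurrentFlow, Sym2.eq_swap]
  ring

/-- Exchanging source and sink reverses the flow: `i_{b → a} = -i_{a → b}`. [folklore] -/
theorem unitCurrentFlow_swap (G : SimpleGraph V) (c : Sym2 V → ℝ≥0) (a b v w : V) :
    unitCurrentFlow G c b a v w = -unitCurrentFlow G c a b v w := by
  simp only [unitCurrentFlow, unitPotential]
  ring

/-- With equal poles there is no flow. [folklore] -/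
@[simp] theorem unitCurrentFlow_self_poles (G : SimpleGraph V) (c : Sym2 V → ℝ≥0) (a v w : V) :
    unitCurrentFlow G c a a v w = 0 := by
  simp only [unitCurrentFlow, unitPotential]
  ring

/-- The flow vanishes at every vertex that is joined by positive conductances to neither pole
(all four resistances in the formula are `(⊤).toReal = 0`, or the pair carries no conductance).
[folklore] -/
theorem unitCurrentFlow_eq_zero_of_not_reachable (hva : ¬ (conductanceGraph G c).Reachable v a)
    (hvb : ¬ (conductanceGraph G c).Reachable v b) (w : V) : unitCurrentFlow G c a b v w = 0 := by
  by_cases hadj : G.Adj v w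
  · by_cases hc : 0 < c s(v, w)
    · have hvw : (conductanceGraph G c).Adj v w := ⟨hadj, hc⟩
      have hwa : ¬ (conductanceGraph G c).Reachable w a := fun h ↦ hva (hvw.reachable.trans h)
      have hwb : ¬ (conductanceGraph G c).Reachable w b := fun h ↦ hvb (hvw.reachable.trans h)
      rw [unitCurrentFlow, unitPotential_sub, pointResistance_of_not_reachable hva,
        pointResistance_of_not_reachable hvb, pointResistance_of_not_reachable hwa,
        pointResistance_of_not_reachable hwb]
      ring
    · exact unitCurrentFlow_of_conductance_eq_zero (conductance_eq_zero_of_not_pos hc)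
  · exact unitCurrentFlow_of_not_adj hadj

/-- **The flow vanishes off the electrical component of the source** (when source and sink are
joined by positive conductances). [folklore] -/
theorem unitCurrentFlow_eq_zero_of_not_reachable_source
    (hab : (conductanceGraph G c).Reachable a b) (hv : ¬ (conductanceGraph G c).Reachable a v)
    (w : V) : unitCurrentFlow G c a b v w = 0 :=
  unitCurrentFlow_eq_zero_of_not_reachable (fun h ↦ hv h.symm) (fun h ↦ hv (hab.trans h.symm)) w

/-- The flow vanishes off the `G`-component of the source when source and sink lie in one
`G`-component. [folklore] -/
theorem unitCurrentFlow_eq_zero_of_not_reachable_source' (hab : G.Reachable a b)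
    (hv : ¬ G.Reachable a v) (w : V) : unitCurrentFlow G c a b v w = 0 :=
  unitCurrentFlow_eq_zero_of_not_reachable
    (fun h ↦ hv (h.mono (conductanceGraph_le G c)).symm)
    (fun h ↦ hv (hab.trans (h.mono (conductanceGraph_le G c)).symm)) w

end Basic

/-! ### The weighted Laplacian; Green's identities; existence of the voltage -/

section Laplacian

variable [Fintype V] (G : SimpleGraph V) [DecidableRel G.Adj] (c : Sym2 V → ℝ≥0)

/-- The weighted Laplacian (net current out of `z` of the potential `φ`):
`(d* c dφ)(z) = Σ_{w ~ z} c(zw) (φ(z) - φ(w))` (Lyons–Peres 2016, §2.4, operators `d`, `d*`;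
Exercise 2.62, the network Laplacian `Δ_G`). [cite: LyonsPeres2016, §2.4, definitions of d and d*] -/
def networkLaplacian (φ : V → ℝ) (z : V) : ℝ :=
  ∑ w, if G.Adj z w then (c s(z, w) : ℝ) * (φ z - φ w) else 0

/-- Unfolding lemma. [folklore] -/
theorem networkLaplacian_apply (φ : V → ℝ) (z : V) :
    networkLaplacian G c φ z = ∑ w, if G.Adj z w then (c s(z, w) : ℝ) * (φ z - φ w) else 0 := rfl

/-- Linearity: sums. [folklore] -/
theorem networkLaplacian_add (φ ψ : V → ℝ) (z : V) :
    networkLaplacian G c (fun y ↦ φ y + ψ y) z = networkLaplacian G c φ z + networkLaplacian G c ψ z := by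
  simp only [networkLaplacian, ← Finset.sum_add_distrib]
  refine Finset.sum_congr rfl fun w _ ↦ ?_
  split_ifs <;> ring

/-- Linearity: scalars. [folklore] -/
theorem networkLaplacian_smul (t : ℝ) (φ : V → ℝ) (z : V) :
    networkLaplacian G c (fun y ↦ t * φ y) z = t * networkLaplacian G c φ z := by
  simp only [networkLaplacian, Finset.mul_sum]
  refine Finset.sum_congr rfl fun w _ ↦ ?_
  split_ifs <;> ring

/-- Linearity: differences. [folklore] -/
theorem networkLaplacian_sub (φ ψ : V → ℝ) (z : V) :
    networkLaplacian G c (fun y ↦ φ y - ψ y) z = networkLaplacian G c φ z - networkLaplacian G c ψ z := by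
  simp only [networkLaplacian, ← Finset.sum_sub_distrib]
  refine Finset.sum_congr rfl fun w _ ↦ ?_
  split_ifs <;> ring

/-- Adding a constant does not change the Laplacian. [folklore] -/
theorem networkLaplacian_sub_const (φ : V → ℝ) (t : ℝ) (z : V) :
    networkLaplacian G c (fun y ↦ φ y - t) z = networkLaplacian G c φ z := by
  simp only [networkLaplacian]
  refine Finset.sum_congr rfl fun w _ ↦ ?_
  split_ifs <;> ring

/-- The zero potential has zero Laplacian. [folklore] -/
@[simp] theorem networkLaplacian_zero (z : V) : networkLaplacian G c (fun _ ↦ 0) z = 0 := by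
  simp [networkLaplacian]

variable [DecidableEq V]

/-- **Flow conservation** for currents (Lyons–Peres 2016, Lemma 2.8): the Laplacian of any
potential sums to zero over all vertices. [cite: LyonsPeres2016, §2.4, Lemma 2.8] -/
theorem sum_networkLaplacian (φ : V → ℝ) : ∑ z, networkLaplacian G c φ z = 0 := by
  simp only [networkLaplacian]
  rw [sum_sum_adj_eq_sum_edgeFinset G (fun z w ↦ (c s(z, w) : ℝ) * (φ z - φ w))]
  refine Finset.sum_eq_zero fun e _ ↦ ?_
  induction e with
  | h a b =>
    simp only [Sym2.lift_mk]
    rw [Sym2.eq_swap (a := b)]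
    ring

/-- The **energy identity** `Σ_z φ(z) (d* c dφ)(z) = Σ_{e ∈ E} c(e) dφ(e)²`
(Lyons–Peres 2016, Exercise 2.62 (f): `(f, Δ_G f) = ‖df‖²_c`; Grimmett 2018, (1.22)).
[cite: LyonsPeres2016, Chapter 2, Additional Exercises, Exercise 2.62 (f)] -/
theorem sum_mul_networkLaplacian_self (φ : V → ℝ) :
    ∑ z, φ z * networkLaplacian G c φ z = ∑ e ∈ G.edgeFinset, (c e : ℝ) * sqIncr φ e := by
  simp only [networkLaplacian, sqIncr_eq_lift]
  exact (sum_edgeFinset_mul_incr G c φ φ).symm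

/-- **Green's identity / adjointness of `d` and `d*`**: `Σ_z ψ(z) (d* c dφ)(z)` is symmetric in
`φ, ψ` (both equal `Σ_e c(e) dφ(e) dψ(e)`; Lyons–Peres 2016, Exercise 2.11).
[cite: LyonsPeres2016, §2.4, Exercise 2.11] -/
theorem sum_mul_networkLaplacian_comm (φ ψ : V → ℝ) :
    ∑ z, ψ z * networkLaplacian G c φ z = ∑ z, φ z * networkLaplacian G c ψ z := by
  simp only [networkLaplacian]
  rw [← sum_edgeFinset_mul_incr G c ψ φ, ← sum_edgeFinset_mul_incr G c φ ψ]
  refine Finset.sum_congr rfl fun e _ ↦ ?_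
  induction e with
  | h a b => simp only [Sym2.lift_mk]; ring

omit [DecidableEq V] in
/-- Zero energy forces equal values across every edge of positive conductance. [folklore] -/
theorem eq_of_energy_eq_zero {φ : V → ℝ} (hE : ∑ e ∈ G.edgeFinset, (c e : ℝ) * sqIncr φ e = 0)
    {x y : V} (hxy : (conductanceGraph G c).Adj x y) : φ x = φ y := by
  have hterm := (Finset.sum_eq_zero_iff_of_nonneg (fun e _ ↦
    mul_nonneg (NNReal.coe_nonneg (c e)) (sqIncr_nonneg φ e))).1 hE s(x, y)
      (mem_edgeFinset.2 ((mem_edgeSet G).2 hxy.1))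
  rw [sqIncr_mk, mul_eq_zero] at hterm
  rcases hterm with h0 | h0
  · exact absurd h0 (NNReal.coe_pos.2 hxy.2).ne'
  · exact sub_eq_zero.1 ((pow_eq_zero_iff two_ne_zero).1 h0)

/-- **Uniqueness principle** (Lyons–Peres 2016, §2.1): a potential with vanishing Laplacian is
constant along edges of positive conductance ... [cite: LyonsPeres2016, §2.1, Uniqueness Principle] -/
theorem eq_of_networkLaplacian_eq_zero {φ : V → ℝ} (h : ∀ z, networkLaplacian G c φ z = 0)
    {x y : V} (hxy : (conductanceGraph G c).Adj x y) : φ x = φ y := by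
  refine eq_of_energy_eq_zero G c ?_ hxy
  rw [← sum_mul_networkLaplacian_self]
  exact Finset.sum_eq_zero fun z _ ↦ by rw [h z, mul_zero]

/-- ... hence constant on every electrical component. [cite: LyonsPeres2016, §2.1, Uniqueness Principle] -/
theorem eq_of_networkLaplacian_eq_zero_of_reachable {φ : V → ℝ}
    (h : ∀ z, networkLaplacian G c φ z = 0) {x y : V} (hxy : (conductanceGraph G c).Reachable x y) :
    φ x = φ y := by
  obtain ⟨p⟩ := hxy
  induction p with
  | nil => rfl
  | cons hadj _ ih => exact (eq_of_networkLaplacian_eq_zero G c h hadj).trans ih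

omit [DecidableEq V] in
/-- A potential supported on the electrical component of `b` has vanishing Laplacian off that
component. [folklore] -/
theorem networkLaplacian_eq_zero_of_not_reachable {φ : V → ℝ} {b z : V}
    (hφ : ∀ y, ¬ (conductanceGraph G c).Reachable b y → φ y = 0)
    (hz : ¬ (conductanceGraph G c).Reachable b z) : networkLaplacian G c φ z = 0 := by
  refine Finset.sum_eq_zero fun w _ ↦ ?_
  split_ifs with hadj
  · by_cases hc : 0 < c s(z, w)
    · have hzw : (conductanceGraph G c).Adj z w := ⟨hadj, hc⟩
      have hw : ¬ (conductanceGraph G c).Reachable b w := fun h ↦ hz (h.trans hzw.symm.reachable)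
      rw [hφ z hz, hφ w hw, sub_self, mul_zero]
    · rw [conductance_eq_zero_of_not_pos hc, NNReal.coe_zero, zero_mul]
  · rfl

/-- A potential harmonic off `{a, b}` with unit net current out of `a` and `-1` out of `b` has
Laplacian `1[z = a] - 1[z = b]`; this is the normalisation used throughout. The zero potential
does it for `a = b`. [folklore] -/
theorem networkLaplacian_zero_eq_single_sub_single (a z : V) :
    networkLaplacian G c (fun _ ↦ 0) z = (if z = a then 1 else 0) - (if z = a then 1 else 0) := by
  rw [networkLaplacian_zero, sub_self]

/-- **Existence of the voltage** (Lyons–Peres 2016, §2.1, existence of the harmonic extension /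
of the current; Grimmett 2018, Theorem 1.16 gives it by the spanning-tree formula): if `a` and
`b` are joined by a path of positive conductance, there is a potential `φ`, grounded at `b` and
vanishing off the electrical component of `b`, whose net current is `1` out of `a`, `-1` out of
`b` and `0` elsewhere. Proof: on the finite-dimensional space of potentials, the linear map
"`φ ↦` (`φ` at `b` and off the component, `d* c dφ` elsewhere)" is injective by the uniqueness
principle, hence surjective. [cite: LyonsPeres2016, §2.1, Existence and Uniqueness Principles] -/
theorem exists_networkLaplacian_eq {a b : V} (hab : (conductanceGraph G c).Reachable a b) :
    ∃ φ : V → ℝ, (∀ z, networkLaplacian G c φ z = (if z = a then 1 else 0) - (if z = b then 1 else 0)) ∧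
      φ b = 0 ∧ ∀ z, ¬ (conductanceGraph G c).Reachable b z → φ z = 0 := by
  classical
  rcases eq_or_ne a b with rfl | hne
  · exact ⟨fun _ ↦ 0, networkLaplacian_zero_eq_single_sub_single G c a, rfl, fun _ _ ↦ rfl⟩
  set H := conductanceGraph G c with hH
  -- the pinned vertices: `b` and everything outside its electrical component
  let P : V → Prop := fun z ↦ z = b ∨ ¬ H.Reachable b z
  let M : (V → ℝ) →ₗ[ℝ] (V → ℝ) :=
    { toFun := fun f z ↦ if P z then f z else networkLaplacian G c f z
      map_add' := fun f g ↦ by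
        funext z
        change (if P z then f z + g z else networkLaplacian G c (fun y ↦ f y + g y) z) =
          (if P z then f z else networkLaplacian G c f z) +
            (if P z then g z else networkLaplacian G c g z)
        rw [networkLaplacian_add]
        split_ifs <;> rfl
      map_smul' := fun t f ↦ by
        funext z
        change (if P z then t * f z else networkLaplacian G c (fun y ↦ t * f y) z) =
          t * (if P z then f z else networkLaplacian G c f z)
        rw [networkLaplacian_smul]
        split_ifs <;> rfl }
  have hM : ∀ f z, M f z = if P z then f z else networkLaplacian G c f z := fun f z ↦ rfl
  -- injectivity, by the uniqueness principle
  have hinj : Function.Injective M := by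
    refine (injective_iff_map_eq_zero M).2 fun f hf ↦ ?_
    have hfz : ∀ z, M f z = 0 := fun z ↦ by rw [hf]; rfl
    have hfb : f b = 0 := by
      have h := hfz b
      rwa [hM, if_pos (Or.inl rfl)] at h
    have hoff : ∀ z, ¬ H.Reachable b z → f z = 0 := fun z hz ↦ by
      have h := hfz z
      rwa [hM, if_pos (Or.inr hz)] at h
    have hint : ∀ z, z ≠ b → networkLaplacian G c f z = 0 := fun z hzb ↦ by
      by_cases hz : H.Reachable b z
      · have h := hfz z
        rwa [hM, if_neg (by rintro (h' | h'); exacts [hzb h', h' hz])] at h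
      · exact networkLaplacian_eq_zero_of_not_reachable G c hoff hz
    have hL : ∀ z, networkLaplacian G c f z = 0 := by
      intro z
      by_cases hzb : z = b
      · rw [hzb]
        have hsum := sum_networkLaplacian G c f
        rwa [← Finset.add_sum_erase _ _ (Finset.mem_univ b),
          Finset.sum_eq_zero (fun w hw ↦ hint w (Finset.ne_of_mem_erase hw)), add_zero] at hsum
      · exact hint z hzb
    funext z
    by_cases hz : H.Reachable b z
    · rw [Pi.zero_apply, ← eq_of_networkLaplacian_eq_zero_of_reachable G c hL hz, hfb]
    · exact hoff z hz
  -- surjectivity: solve for the right-hand side `1[z = a]`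
  obtain ⟨φ, hφ⟩ := LinearMap.injective_iff_surjective.1 hinj fun z ↦ if z = a then 1 else 0
  have hφz : ∀ z, M φ z = if z = a then 1 else 0 := fun z ↦ by rw [hφ]
  have hba : H.Reachable b a := hab.symm
  have hφb : φ b = 0 := by
    have h := hφz b
    rwa [hM, if_pos (Or.inl rfl), if_neg (Ne.symm hne)] at h
  have hoff : ∀ z, ¬ H.Reachable b z → φ z = 0 := fun z hz ↦ by
    have h := hφz z
    have hza : z ≠ a := by
      rintro rfl
      exact hz hba
    rwa [hM, if_pos (Or.inr hz), if_neg hza] at h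
  have hint : ∀ z, z ≠ b → networkLaplacian G c φ z = if z = a then 1 else 0 := fun z hzb ↦ by
    by_cases hz : H.Reachable b z
    · have h := hφz z
      rwa [hM, if_neg (by rintro (h' | h'); exacts [hzb h', h' hz])] at h
    · have hza : z ≠ a := by
        rintro rfl
        exact hz hba
      rw [networkLaplacian_eq_zero_of_not_reachable G c hoff hz, if_neg hza]
  refine ⟨φ, fun z ↦ ?_, hφb, hoff⟩
  by_cases hzb : z = b
  · rw [hzb, if_neg (Ne.symm hne), if_pos rfl]
    have hsum := sum_networkLaplacian G c φ
    rw [← Finset.add_sum_erase _ _ (Finset.mem_univ b),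
      Finset.sum_congr rfl (fun w hw ↦ hint w (Finset.ne_of_mem_erase hw)),
      Finset.sum_ite_eq' (Finset.univ.erase b) a (fun _ ↦ (1 : ℝ)),
      if_pos (Finset.mem_erase.2 ⟨hne, Finset.mem_univ a⟩)] at hsum
    linarith
  · rw [hint z hzb, if_neg hzb, sub_zero]

/-- **The voltage drop is the effective resistance**: if `d* c dφ = 1_a - 1_b` then
`ℛ(a ↔ b) = φ(a) - φ(b)` (Lyons–Peres 2016, (2.5): `v(a) = ℛ(a ↔ Z)` for a unit current with
zero voltage on `Z`; Grimmett 2018, (1.23)–(1.24)). Here `ℛ` is the Dirichlet infimum of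
`EffectiveResistance.lean`, and the identification is Dirichlet's principle
`effectiveConductance_eq_of_harmonic`. [cite: LyonsPeres2016, §2.2, eq. (2.5)] -/
theorem pointResistance_eq_of_networkLaplacian {a b : V} {φ : V → ℝ}
    (hφ : ∀ z, networkLaplacian G c φ z = (if z = a then 1 else 0) - (if z = b then 1 else 0)) :
    pointResistance G c a b = φ a - φ b := by
  rcases eq_or_ne a b with rfl | hab
  · rw [pointResistance_self, sub_self]
  set N : V → ℝ := fun z ↦ φ z - φ b with hN
  have hLN : ∀ z, networkLaplacian G c N z = networkLaplacian G c φ z :=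
    networkLaplacian_sub_const G c φ (φ b)
  -- the energy of `N` is `φ a - φ b`
  have hE : ∑ e ∈ G.edgeFinset, (c e : ℝ) * sqIncr N e = φ a - φ b := by
    rw [← sum_mul_networkLaplacian_self]
    simp_rw [hLN, hφ, mul_sub, Finset.sum_sub_distrib, mul_ite, mul_one, mul_zero,
      Finset.sum_ite_eq' Finset.univ, Finset.mem_univ, if_true, hN, sub_self, sub_zero]
  have hD : 0 ≤ φ a - φ b :=
    hE ▸ Finset.sum_nonneg fun e _ ↦ mul_nonneg (NNReal.coe_nonneg _) (sqIncr_nonneg N e)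
  have hD' : φ a - φ b ≠ 0 := by
    intro h0
    have hconst : ∀ x y, (conductanceGraph G c).Adj x y → N x = N y := fun x y hxy ↦
      eq_of_energy_eq_zero G c (hE.trans h0) hxy
    have hzero : networkLaplacian G c N a = 0 := by
      refine Finset.sum_eq_zero fun w _ ↦ ?_
      split_ifs with hadj
      · by_cases hc : 0 < c s(a, w)
        · rw [hconst a w ⟨hadj, hc⟩, sub_self, mul_zero]
        · rw [conductance_eq_zero_of_not_pos hc, NNReal.coe_zero, zero_mul]
      · rfl
    rw [hLN, hφ, if_pos rfl, if_neg hab] at hzero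
    norm_num at hzero
  have hDpos : 0 < φ a - φ b := lt_of_le_of_ne hD (Ne.symm hD')
  have hC := effectiveConductance_eq_of_harmonic G c (x := a) (y := b) N (D := φ a - φ b) (Tw := 1)
    hDpos (by simp [hN]) (by simp [hN]) fun z hzb ↦ by
      change networkLaplacian G c N z = _
      rw [hLN, hφ, if_neg hzb, sub_zero]
  rw [pointResistance, effectiveResistance_def, hC, one_div, ENNReal.ofReal_inv_of_pos hDpos,
    inv_inv, ENNReal.toReal_ofReal hD]

/-- **Reciprocity** (symmetry of the grounded Green kernel, Lyons–Peres 2016, Exercise 2.62 (b):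
`v_b(z, a) = v_b(a, z)`; cf. the reciprocity law (2.12)): the voltage at `z` of the unit current
`a → b` equals the voltage at `a` of the unit current `z → b`, both grounded at `b`.
[cite: LyonsPeres2016, Chapter 2, Additional Exercises, Exercise 2.62 (b)] -/
theorem green_reciprocity {a b z : V} {φ ψ : V → ℝ}
    (hφ : ∀ y, networkLaplacian G c φ y = (if y = a then 1 else 0) - (if y = b then 1 else 0))
    (hψ : ∀ y, networkLaplacian G c ψ y = (if y = z then 1 else 0) - (if y = b then 1 else 0)) :
    φ z - φ b = ψ a - ψ b := by
  have h := sum_mul_networkLaplacian_comm G c (fun y ↦ φ y - φ b) (fun y ↦ ψ y - ψ b)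
  simp_rw [networkLaplacian_sub_const, hφ, hψ, mul_sub, Finset.sum_sub_distrib, mul_ite, mul_one,
    mul_zero, Finset.sum_ite_eq' Finset.univ, Finset.mem_univ, if_true, sub_self, sub_zero] at h
  linarith

/-- **Tetali's formula** (Tetali 1991; Lyons–Peres 2016, Exercise 2.68): if `a, b` are joined by
positive conductances and `d* c dφ = 1_a - 1_b`, then at every vertex `z` of the electrical
component of `b`, `φ(z) - φ(b) = (ℛ(a ↔ b) + ℛ(z ↔ b) - ℛ(z ↔ a)) / 2 = unitPotential G c a b z`.
Proof: `ℛ = ` voltage drop for the three unit currents `a → b`, `z → b`, `z → a = (z → b) - (a → b)`,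
plus reciprocity. [cite: LyonsPeres2016, Chapter 2, Additional Exercises, Exercise 2.68] -/
theorem unitPotential_eq_of_networkLaplacian {a b z : V} {φ : V → ℝ}
    (hzb : (conductanceGraph G c).Reachable z b)
    (hφ : ∀ y, networkLaplacian G c φ y = (if y = a then 1 else 0) - (if y = b then 1 else 0)) :
    unitPotential G c a b z = φ z - φ b := by
  obtain ⟨ψ, hψ, -, -⟩ := exists_networkLaplacian_eq G c hzb
  have hRab := pointResistance_eq_of_networkLaplacian G c hφ
  have hRzb := pointResistance_eq_of_networkLaplacian G c hψ
  have hRza : pointResistance G c z a = (ψ z - φ z) - (ψ a - φ a) := by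
    refine pointResistance_eq_of_networkLaplacian G c (φ := fun y ↦ ψ y - φ y) fun y ↦ ?_
    rw [networkLaplacian_sub, hψ, hφ]
    ring
  have hrec := green_reciprocity G c hφ hψ
  rw [unitPotential, hRab, hRzb, hRza]
  linarith

/-- On the electrical component of `b`, the unit current flow is `c dφ` for ANY potential `φ`
with `d* c dφ = 1_a - 1_b` (Ohm's law for the true voltage). [cite: LyonsPeres2016, §2.1, Ohm's Law] -/
theorem unitCurrentFlow_eq_of_networkLaplacian {a b v w : V} {φ : V → ℝ}
    (hvb : (conductanceGraph G c).Reachable v b)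
    (hφ : ∀ y, networkLaplacian G c φ y = (if y = a then 1 else 0) - (if y = b then 1 else 0)) :
    unitCurrentFlow G c a b v w = if G.Adj v w then (c s(v, w) : ℝ) * (φ v - φ w) else 0 := by
  by_cases hadj : G.Adj v w
  · rw [if_pos hadj, unitCurrentFlow_of_adj' hadj]
    by_cases hc : 0 < c s(v, w)
    · have hwb : (conductanceGraph G c).Reachable w b :=
        (show (conductanceGraph G c).Adj v w from ⟨hadj, hc⟩).symm.reachable.trans hvb
      rw [unitPotential_eq_of_networkLaplacian G c hvb hφ,
        unitPotential_eq_of_networkLaplacian G c hwb hφ]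
      ring
    · rw [conductance_eq_zero_of_not_pos hc, NNReal.coe_zero, zero_mul, zero_mul]
  · rw [if_neg hadj, unitCurrentFlow_of_not_adj hadj]

end Laplacian

/-! ### Kirchhoff's node law, the unit bound, the energy identity -/

section NodeLaw

variable [Fintype V] {G : SimpleGraph V} {c : Sym2 V → ℝ≥0} {a b : V}

/-- **Kirchhoff's node law for the unit current flow, at every vertex** (Lyons–Peres 2016, §2.1:
the current is a flow between `a` and `b`, of unit strength, "the sum of the currents at every
vertex is 0, not merely off `{a, b}`" once the battery is counted; Grimmett 2018, Definition 1.14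
and Theorem 1.16): if `a` and `b` are joined by a path of positive conductance, then for every
vertex `v`, `Σ_w i(v, w) = 1[v = a] - 1[v = b]`. [cite: LyonsPeres2016, §2.1, Kirchhoff's Node Law] -/
theorem sum_unitCurrentFlow [DecidableEq V] (hab : (conductanceGraph G c).Reachable a b) (v : V) :
    ∑ w, unitCurrentFlow G c a b v w = (if v = a then 1 else 0) - (if v = b then 1 else 0) := by
  classical
  obtain ⟨φ, hφ, -, -⟩ := exists_networkLaplacian_eq G c hab
  by_cases hv : (conductanceGraph G c).Reachable v b
  · rw [← hφ v, networkLaplacian_apply]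
    exact Finset.sum_congr rfl fun w _ ↦ unitCurrentFlow_eq_of_networkLaplacian G c hv hφ
  · have hva : ¬ (conductanceGraph G c).Reachable v a := fun h ↦ hv (h.trans hab)
    have h1 : v ≠ a := by
      rintro rfl
      exact hva (Reachable.refl _)
    have h2 : v ≠ b := by
      rintro rfl
      exact hv (Reachable.refl _)
    rw [if_neg h1, if_neg h2, sub_zero]
    exact Finset.sum_eq_zero fun w _ ↦ unitCurrentFlow_eq_zero_of_not_reachable hva hv w

/-- Kirchhoff's node law under the hypothesis `ℛ(a ↔ b) ≠ ⊤`. [cite: LyonsPeres2016, §2.1, Kirchhoff's Node Law] -/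
theorem sum_unitCurrentFlow_of_ne_top [DecidableEq V] (hab : effectiveResistance G c {a} {b} ≠ ⊤)
    (v : V) :
    ∑ w, unitCurrentFlow G c a b v w = (if v = a then 1 else 0) - (if v = b then 1 else 0) :=
  sum_unitCurrentFlow (effectiveResistance_ne_top_iff.1 hab) v

/-- Kirchhoff's node law on a network whose source and sink are joined in `G` and whose
conductances are positive on all edges (e.g. a connected graph with unit conductances).
[cite: LyonsPeres2016, §2.1, Kirchhoff's Node Law] -/
theorem sum_unitCurrentFlow_of_pos [DecidableEq V] (hpos : ∀ e ∈ G.edgeSet, 0 < c e)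
    (hab : G.Reachable a b) (v : V) :
    ∑ w, unitCurrentFlow G c a b v w = (if v = a then 1 else 0) - (if v = b then 1 else 0) :=
  sum_unitCurrentFlow (by rwa [conductanceGraph_eq_of_pos hpos]) v

/-- Node law off the poles: `Σ_w i(v, w) = 0` for `v ∉ {a, b}` (the flow property,
Grimmett 2018, Definition 1.14 (c)). [cite: Grimmett2018, §1.1, Definition 1.14 (c)] -/
theorem sum_unitCurrentFlow_of_ne [DecidableEq V] (hab : (conductanceGraph G c).Reachable a b)
    {v : V} (hva : v ≠ a) (hvb : v ≠ b) : ∑ w, unitCurrentFlow G c a b v w = 0 := by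
  rw [sum_unitCurrentFlow hab, if_neg hva, if_neg hvb, sub_zero]

/-- Unit strength: `Σ_w i(a, w) = 1` for `a ≠ b`. [cite: Grimmett2018, §1.1, Definition 1.14 and "unit flow"] -/
theorem sum_unitCurrentFlow_source [DecidableEq V] (hab : (conductanceGraph G c).Reachable a b)
    (hne : a ≠ b) : ∑ w, unitCurrentFlow G c a b a w = 1 := by
  rw [sum_unitCurrentFlow hab, if_pos rfl, if_neg hne, sub_zero]

/-- `Σ_w i(b, w) = -1` for `a ≠ b`. [cite: Grimmett2018, §1.1, Definition 1.14, J_s = -J_t] -/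
theorem sum_unitCurrentFlow_sink [DecidableEq V] (hab : (conductanceGraph G c).Reachable a b)
    (hne : a ≠ b) : ∑ w, unitCurrentFlow G c a b b w = -1 := by
  rw [sum_unitCurrentFlow hab, if_neg (Ne.symm hne), if_pos rfl, zero_sub]

/-- **The unit current flow is bounded by one**: `i(v, w) ≤ 1` on every pair (a current is
acyclic — it is the gradient flow of its voltage — so the flow through `vw` is at most the net
flow `1[a ∈ S] - 1[b ∈ S] ≤ 1` out of the cut `S = {φ > φ(w)}`, all of whose boundary terms are
nonnegative). [folklore] -/
theorem unitCurrentFlow_le_one (hab : (conductanceGraph G c).Reachable a b) (v w : V) :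
    unitCurrentFlow G c a b v w ≤ 1 := by
  classical
  by_cases hpos : 0 < unitCurrentFlow G c a b v w
  swap
  · exact (not_lt.1 hpos).trans zero_le_one
  set φ := unitPotential G c a b with hφ
  have hκ : ∀ x y, 0 ≤ G.edgeSet.indicator (fun e ↦ (c e : ℝ)) s(x, y) := fun x y ↦
    Set.indicator_nonneg (fun _ _ ↦ NNReal.coe_nonneg _) _
  have hvw : φ w < φ v := by
    by_contra h
    refine absurd hpos (not_lt.2 ?_)
    exact mul_nonpos_of_nonneg_of_nonpos (hκ v w) (sub_nonpos.2 (not_lt.1 h))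
  set S : Finset V := Finset.univ.filter fun z ↦ φ w < φ z with hS
  have hvS : v ∈ S := Finset.mem_filter.2 ⟨Finset.mem_univ _, hvw⟩
  have hwS : w ∈ Sᶜ := Finset.mem_compl.2 fun h ↦ lt_irrefl _ (Finset.mem_filter.1 h).2
  -- (1) the net flow out of `S` is at most one
  have h1 : ∑ z ∈ S, ∑ y, unitCurrentFlow G c a b z y ≤ 1 := by
    rw [Finset.sum_congr rfl fun z _ ↦ sum_unitCurrentFlow hab z, Finset.sum_sub_distrib,
      Finset.sum_ite_eq' S a, Finset.sum_ite_eq' S b]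
    split_ifs <;> norm_num
  -- (2) the flow inside `S` cancels
  have h2 : ∑ z ∈ S, ∑ y, unitCurrentFlow G c a b z y =
      ∑ z ∈ S, ∑ y ∈ Sᶜ, unitCurrentFlow G c a b z y := by
    rw [← Finset.sum_congr rfl fun z _ ↦
      Finset.sum_add_sum_compl S (fun y ↦ unitCurrentFlow G c a b z y), Finset.sum_add_distrib]
    have hSS : ∑ z ∈ S, ∑ y ∈ S, unitCurrentFlow G c a b z y =
        -∑ z ∈ S, ∑ y ∈ S, unitCurrentFlow G c a b z y := by
      conv_rhs => rw [Finset.sum_comm]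
      rw [← Finset.sum_neg_distrib]
      refine Finset.sum_congr rfl fun z _ ↦ ?_
      rw [← Finset.sum_neg_distrib]
      exact Finset.sum_congr rfl fun y _ ↦ by rw [← unitCurrentFlow_anti]
    have hSS0 : ∑ z ∈ S, ∑ y ∈ S, unitCurrentFlow G c a b z y = 0 := by linarith
    rw [hSS0, zero_add]
  -- (3) every boundary term is nonnegative, and `(v, w)` is one of them
  have hnn : ∀ z ∈ S, ∀ y ∈ Sᶜ, 0 ≤ unitCurrentFlow G c a b z y := fun z hz y hy ↦ by
    have hz' : φ w < φ z := (Finset.mem_filter.1 hz).2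
    have hy' : φ y ≤ φ w :=
      not_lt.1 fun h ↦ Finset.mem_compl.1 hy (Finset.mem_filter.2 ⟨Finset.mem_univ _, h⟩)
    show 0 ≤ G.edgeSet.indicator (fun e ↦ (c e : ℝ)) s(z, y) * (φ z - φ y)
    exact mul_nonneg (hκ z y) (by linarith)
  have h3 : unitCurrentFlow G c a b v w ≤ ∑ z ∈ S, ∑ y ∈ Sᶜ, unitCurrentFlow G c a b z y :=
    calc unitCurrentFlow G c a b v w ≤ ∑ y ∈ Sᶜ, unitCurrentFlow G c a b v y :=
          Finset.single_le_sum (fun y hy ↦ hnn v hvS y hy) hwS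
      _ ≤ ∑ z ∈ S, ∑ y ∈ Sᶜ, unitCurrentFlow G c a b z y :=
          Finset.single_le_sum (f := fun z ↦ ∑ y ∈ Sᶜ, unitCurrentFlow G c a b z y)
            (fun z hz ↦ Finset.sum_nonneg fun y hy ↦ hnn z hz y hy) hvS
  linarith

/-- `|i(v, w)| ≤ 1` for the unit current flow (used as: "`|θ| ≤ 1` bondwise, an acyclic unit
flow"). [folklore] -/
theorem abs_unitCurrentFlow_le_one (hab : (conductanceGraph G c).Reachable a b) (v w : V) :
    |unitCurrentFlow G c a b v w| ≤ 1 := by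
  refine abs_le.2 ⟨?_, unitCurrentFlow_le_one hab v w⟩
  have h := unitCurrentFlow_le_one hab w v
  rw [unitCurrentFlow_anti] at h
  linarith

/-- **Energy of the unit current flow** (Lyons–Peres 2016, (2.7): `ℰ(i) = ℛ(a ↔ z)`; Grimmett
2018, Lemma 1.25 — the value of the minimum in Thomson's principle): if `a, b` are joined by
positive conductances, `Σ_v Σ_w i(v, w)² / c(vw) = 2 ℛ(a ↔ b)` (each edge counted twice; pairs
with `c(vw) = 0` carry no flow and contribute `0`). [cite: LyonsPeres2016, §2.4, eq. (2.7)] -/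
theorem sum_unitCurrentFlow_sq_div [DecidableEq V] (hab : (conductanceGraph G c).Reachable a b) :
    ∑ v, ∑ w, unitCurrentFlow G c a b v w ^ 2 / (c s(v, w) : ℝ) = 2 * pointResistance G c a b := by
  classical
  obtain ⟨φ, hφ, -, hoff⟩ := exists_networkLaplacian_eq G c hab
  -- termwise: `i(v,w)²/c(vw) = 1[v ~ w] c(vw) (φ v - φ w)²`
  have hterm : ∀ v w, unitCurrentFlow G c a b v w ^ 2 / (c s(v, w) : ℝ) =
      if G.Adj v w then (c s(v, w) : ℝ) * ((φ v - φ w) * (φ v - φ w)) else 0 := by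
    intro v w
    by_cases hadj : G.Adj v w
    · rw [if_pos hadj]
      by_cases hc : 0 < c s(v, w)
      · have hc' : (c s(v, w) : ℝ) ≠ 0 := (NNReal.coe_pos.2 hc).ne'
        by_cases hv : (conductanceGraph G c).Reachable v b
        · rw [unitCurrentFlow_eq_of_networkLaplacian G c hv hφ, if_pos hadj, div_eq_iff hc']
          ring
        · have hw : ¬ (conductanceGraph G c).Reachable w b := fun h ↦
            hv ((show (conductanceGraph G c).Adj v w from ⟨hadj, hc⟩).reachable.trans h)
          rw [unitCurrentFlow_eq_zero_of_not_reachable (fun h ↦ hv (h.trans hab)) hv w,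
            hoff v (fun h ↦ hv h.symm), hoff w (fun h ↦ hw h.symm)]
          simp
      · rw [conductance_eq_zero_of_not_pos hc, unitCurrentFlow_of_conductance_eq_zero
          (conductance_eq_zero_of_not_pos hc)]
        simp
    · rw [if_neg hadj, unitCurrentFlow_of_not_adj hadj]
      simp
  simp_rw [hterm]
  rw [sum_sum_adj_eq_sum_edgeFinset G, pointResistance_eq_of_networkLaplacian G c hφ]
  have hE := sum_mul_networkLaplacian_self G c φ
  simp_rw [hφ, mul_sub, Finset.sum_sub_distrib, mul_ite, mul_one, mul_zero,
    Finset.sum_ite_eq' Finset.univ, Finset.mem_univ, if_true] at hE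
  rw [hE, Finset.mul_sum]
  refine Finset.sum_congr rfl fun e _ ↦ ?_
  induction e with
  | h x y =>
    simp only [Sym2.lift_mk, sqIncr_mk]
    rw [Sym2.eq_swap (a := y)]
    ring

/-- **Thomson's principle**, Pythagorean form (Lyons–Peres 2016, §2.4, (2.10):
`‖θ‖²_r = ‖i‖²_r + ‖θ - i‖²_r`; Grimmett 2018, proof of Theorem 1.28): for every unit flow `θ`
from `a` to `b` — antisymmetric, supported on the edges of positive conductance, with
`Σ_w θ(v, w) = 1[v = a] - 1[v = b]` at every vertex — the energy splits as
`Σ θ²/c = Σ i²/c + Σ (θ - i)²/c`, `i` the unit current flow (the cross term vanishes because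
`i = c dφ` and `θ - i` is sourceless). [cite: LyonsPeres2016, §2.4, eq. (2.10) and Thomson's Principle] -/
theorem sum_sq_div_eq_add [DecidableEq V] (hab : (conductanceGraph G c).Reachable a b)
    (θ : V → V → ℝ) (hanti : ∀ v w, θ w v = -θ v w)
    (hsupp : ∀ v w, θ v w ≠ 0 → (conductanceGraph G c).Adj v w)
    (hdiv : ∀ v, ∑ w, θ v w = (if v = a then 1 else 0) - (if v = b then 1 else 0)) :
    ∑ v, ∑ w, θ v w ^ 2 / (c s(v, w) : ℝ) =
      ∑ v, ∑ w, unitCurrentFlow G c a b v w ^ 2 / (c s(v, w) : ℝ) +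
        ∑ v, ∑ w, (θ v w - unitCurrentFlow G c a b v w) ^ 2 / (c s(v, w) : ℝ) := by
  classical
  obtain ⟨φ, hφ, -, hoff⟩ := exists_networkLaplacian_eq G c hab
  -- `θ - i` is a sourceless antisymmetric flow
  have hk0 : ∀ v, ∑ w, (θ v w - unitCurrentFlow G c a b v w) = 0 := fun v ↦ by
    rw [Finset.sum_sub_distrib, hdiv v, sum_unitCurrentFlow hab v, sub_self]
  have hkanti : ∀ v w, θ v w - unitCurrentFlow G c a b v w =
      -(θ w v - unitCurrentFlow G c a b w v) := fun v w ↦ by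
    rw [hanti w v, unitCurrentFlow_anti G c a b w v]
    ring
  -- the cross term, edge by edge: `i (θ - i) / c = dφ · (θ - i)`
  have hterm : ∀ v w, unitCurrentFlow G c a b v w * (θ v w - unitCurrentFlow G c a b v w) /
      (c s(v, w) : ℝ) = (φ v - φ w) * (θ v w - unitCurrentFlow G c a b v w) := by
    intro v w
    by_cases hH : (conductanceGraph G c).Adj v w
    · have hc : (c s(v, w) : ℝ) ≠ 0 := (NNReal.coe_pos.2 hH.2).ne'
      by_cases hv : (conductanceGraph G c).Reachable v b
      · rw [div_eq_iff hc, unitCurrentFlow_eq_of_networkLaplacian G c hv hφ, if_pos hH.1]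
        ring
      · have hw : ¬ (conductanceGraph G c).Reachable w b := fun h ↦ hv (hH.reachable.trans h)
        rw [unitCurrentFlow_eq_zero_of_not_reachable (fun h ↦ hv (h.trans hab)) hv w,
          hoff v (fun h ↦ hv h.symm), hoff w (fun h ↦ hw h.symm)]
        simp
    · have hθ : θ v w = 0 := by_contra fun h ↦ hH (hsupp v w h)
      rw [unitCurrentFlow_of_not_conductanceGraph_adj hH, hθ]
      simp
  have hcross : ∑ v, ∑ w, unitCurrentFlow G c a b v w * (θ v w - unitCurrentFlow G c a b v w) /
      (c s(v, w) : ℝ) = 0 := by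
    simp_rw [hterm, sub_mul, Finset.sum_sub_distrib]
    have h1 : ∑ v, ∑ w, φ v * (θ v w - unitCurrentFlow G c a b v w) = 0 :=
      Finset.sum_eq_zero fun v _ ↦ by rw [← Finset.mul_sum, hk0 v, mul_zero]
    have h2 : ∑ v, ∑ w, φ w * (θ v w - unitCurrentFlow G c a b v w) = 0 := by
      rw [Finset.sum_comm]
      refine Finset.sum_eq_zero fun w _ ↦ ?_
      rw [← Finset.mul_sum, Finset.sum_congr rfl fun v _ ↦ hkanti v w, Finset.sum_neg_distrib,
        hk0 w, neg_zero, mul_zero]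
    rw [h1, h2, sub_self]
  -- expand `θ² = (i + (θ - i))²`
  have hexp : ∀ v w, θ v w ^ 2 / (c s(v, w) : ℝ) =
      unitCurrentFlow G c a b v w ^ 2 / (c s(v, w) : ℝ) +
        (θ v w - unitCurrentFlow G c a b v w) ^ 2 / (c s(v, w) : ℝ) +
        2 * (unitCurrentFlow G c a b v w * (θ v w - unitCurrentFlow G c a b v w) /
          (c s(v, w) : ℝ)) := fun v w ↦ by ring
  simp_rw [hexp, Finset.sum_add_distrib, ← Finset.mul_sum, hcross, mul_zero, add_zero]

/-- **Thomson's principle** (Lyons–Peres 2016, §2.4; Grimmett 2018, Theorem 1.28): among all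
unit flows from `a` to `b` supported on the edges of positive conductance, the unit current flow
minimises the energy `Σ_{v,w} θ(v, w)² / c(vw)` (whose minimum value is `2 ℛ(a ↔ b)`,
`sum_unitCurrentFlow_sq_div`). [cite: LyonsPeres2016, §2.4, Thomson's Principle] -/
theorem sum_unitCurrentFlow_sq_div_le [DecidableEq V] (hab : (conductanceGraph G c).Reachable a b)
    (θ : V → V → ℝ) (hanti : ∀ v w, θ w v = -θ v w)
    (hsupp : ∀ v w, θ v w ≠ 0 → (conductanceGraph G c).Adj v w)
    (hdiv : ∀ v, ∑ w, θ v w = (if v = a then 1 else 0) - (if v = b then 1 else 0)) :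
    ∑ v, ∑ w, unitCurrentFlow G c a b v w ^ 2 / (c s(v, w) : ℝ) ≤
      ∑ v, ∑ w, θ v w ^ 2 / (c s(v, w) : ℝ) := by
  rw [sum_sq_div_eq_add hab θ hanti hsupp hdiv]
  exact le_add_of_nonneg_right (Finset.sum_nonneg fun v _ ↦ Finset.sum_nonneg fun w _ ↦
    div_nonneg (sq_nonneg _) (NNReal.coe_nonneg _))

/-- **Uniqueness in Thomson's principle** ("`ℰ(θ) > ℰ(i)` unless `θ = i`", Lyons–Peres 2016,
§2.4; Grimmett 2018, Theorem 1.28): a unit flow supported on the edges of positive conductance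
whose energy does not exceed that of the unit current flow is the unit current flow.
[cite: LyonsPeres2016, §2.4, Thomson's Principle] -/
theorem eq_unitCurrentFlow_of_sum_sq_div_le [DecidableEq V]
    (hab : (conductanceGraph G c).Reachable a b)
    (θ : V → V → ℝ) (hanti : ∀ v w, θ w v = -θ v w)
    (hsupp : ∀ v w, θ v w ≠ 0 → (conductanceGraph G c).Adj v w)
    (hdiv : ∀ v, ∑ w, θ v w = (if v = a then 1 else 0) - (if v = b then 1 else 0))
    (hle : ∑ v, ∑ w, θ v w ^ 2 / (c s(v, w) : ℝ) ≤
      ∑ v, ∑ w, unitCurrentFlow G c a b v w ^ 2 / (c s(v, w) : ℝ)) :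
    θ = unitCurrentFlow G c a b := by
  have hsplit := sum_sq_div_eq_add hab θ hanti hsupp hdiv
  have hnn : ∀ v w, 0 ≤ (θ v w - unitCurrentFlow G c a b v w) ^ 2 / (c s(v, w) : ℝ) :=
    fun v w ↦ div_nonneg (sq_nonneg _) (NNReal.coe_nonneg _)
  have hzero : ∑ v, ∑ w, (θ v w - unitCurrentFlow G c a b v w) ^ 2 / (c s(v, w) : ℝ) = 0 :=
    le_antisymm (by linarith) (Finset.sum_nonneg fun v _ ↦ Finset.sum_nonneg fun w _ ↦ hnn v w)
  funext v w
  have hvw := (Finset.sum_eq_zero_iff_of_nonneg fun w _ ↦ hnn v w).1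
    ((Finset.sum_eq_zero_iff_of_nonneg fun v _ ↦ Finset.sum_nonneg fun w _ ↦ hnn v w).1 hzero v
      (Finset.mem_univ v)) w (Finset.mem_univ w)
  by_cases hH : (conductanceGraph G c).Adj v w
  · have hc : (0 : ℝ) < c s(v, w) := NNReal.coe_pos.2 hH.2
    rw [div_eq_zero_iff, or_iff_left hc.ne'] at hvw
    exact sub_eq_zero.1 ((pow_eq_zero_iff two_ne_zero).1 hvw)
  · rw [unitCurrentFlow_of_not_conductanceGraph_adj hH]
    exact by_contra fun h ↦ hH (hsupp v w h)

end NodeLaw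

/-! ### Kirchhoff's theorem: the unit current flow as a spanning-tree sum -/

section Kirchhoff

variable [Fintype V] [DecidableEq V] (G : SimpleGraph V) [DecidableRel G.Adj] (c : Sym2 V → ℝ≥0)

open Classical in
/-- The 2-forest potential of `EffectiveResistanceProofs.lean` has Laplacian
`Tw · (1_a - 1_b)` at every vertex (at `b` by flow conservation), `Tw = Σ_T wt(T)`.
[cite: Grimmett2018, §1.2, Theorem 1.16 and its proof] -/
theorem networkLaplacian_twoForestPotential (a b z : V) :
    networkLaplacian G c (fun z ↦ ∑ F ∈ twoForestEdgeSets G a b,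
        if (fromEdgeSet (F : Set (Sym2 V))).Reachable a z then ∏ f ∈ F, (c f : ℝ) else 0) z =
      (∑ T ∈ spanningTreeEdgeSets G, ∏ f ∈ T, (c f : ℝ)) *
        ((if z = a then 1 else 0) - (if z = b then 1 else 0)) := by
  set N : V → ℝ := fun z ↦ ∑ F ∈ twoForestEdgeSets G a b,
    if (fromEdgeSet (F : Set (Sym2 V))).Reachable a z then ∏ f ∈ F, (c f : ℝ) else 0 with hN
  set Tw : ℝ := ∑ T ∈ spanningTreeEdgeSets G, ∏ f ∈ T, (c f : ℝ) with hTw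
  have hoff : ∀ z, z ≠ b → networkLaplacian G c N z = if z = a then Tw else 0 := fun z hzb ↦
    laplacian_twoForestPotential G c a b z hzb
  by_cases hzb : z = b
  · rw [hzb]
    have hsum := sum_networkLaplacian G c N
    rw [← Finset.add_sum_erase _ _ (Finset.mem_univ b),
      Finset.sum_congr rfl (fun w hw ↦ hoff w (Finset.ne_of_mem_erase hw)),
      Finset.sum_ite_eq' (Finset.univ.erase b) a (fun _ ↦ Tw)] at hsum
    by_cases hab : a = b
    · rw [if_neg (by simp [hab])] at hsum
      rw [hab, sub_self, mul_zero]
      linarith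
    · rw [if_pos (Finset.mem_erase.2 ⟨hab, Finset.mem_univ a⟩)] at hsum
      rw [if_neg (Ne.symm hab), if_pos rfl]
      linarith
  · rw [hoff z hzb, if_neg hzb, sub_zero, mul_ite, mul_one, mul_zero]

open Classical in
/-- The bush–tree correspondence, signed form (Grimmett 2018, proof of Theorem 1.16): for the
2-forest potential `N` of the poles `a, b`, `c(vw) (N(v) - N(w))` is the signed weighted count of
the spanning trees whose `a`–`b` path traverses `vw` forwards minus backwards.
[cite: Grimmett2018, §1.2, Theorem 1.16 and its proof] -/
theorem conductance_mul_twoForestPotential_sub (a b v w : V) (hadj : G.Adj v w) :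
    (c s(v, w) : ℝ) * ((∑ F ∈ twoForestEdgeSets G a b,
        if (fromEdgeSet (F : Set (Sym2 V))).Reachable a v then ∏ f ∈ F, (c f : ℝ) else 0) -
      ∑ F ∈ twoForestEdgeSets G a b,
        if (fromEdgeSet (F : Set (Sym2 V))).Reachable a w then ∏ f ∈ F, (c f : ℝ) else 0) =
    ∑ T ∈ spanningTreeEdgeSets G,
      ((if s(v, w) ∈ T ∧ (fromEdgeSet (T.erase s(v, w) : Set (Sym2 V))).Reachable a v ∧
            (fromEdgeSet (T.erase s(v, w) : Set (Sym2 V))).Reachable b w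
          then ∏ f ∈ T, (c f : ℝ) else 0) -
        (if s(v, w) ∈ T ∧ (fromEdgeSet (T.erase s(v, w) : Set (Sym2 V))).Reachable b v ∧
            (fromEdgeSet (T.erase s(v, w) : Set (Sym2 V))).Reachable a w
          then ∏ f ∈ T, (c f : ℝ) else 0)) := by
  rw [Finset.sum_sub_distrib, ← sum_twoForest_cross_eq_sum_tree G c a b v w,
    ← sum_twoForest_cross_eq_sum_tree G c b a v w, twoForestEdgeSets_comm G b a,
    ← Finset.sum_sub_distrib, ← Finset.sum_sub_distrib, Finset.mul_sum]
  refine Finset.sum_congr rfl fun F hF ↦ ?_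
  rw [ite_reachable_sub_ite_reachable G hF v w, mul_sub]
  simp only [hadj, true_and, mul_ite, mul_zero]

open Classical in
/-- **Kirchhoff's theorem** (Kirchhoff 1847; Grimmett 2018, Theorem 1.16 with (1.18);
Lyons–Peres 2016, §4.2): on a finite connected network with positive conductances, for all
`a, b` and every ordered pair `(v, w)`,
`i(v, w) · Σ_T wt(T) = Σ_T wt(T) (1[T ∈ 𝒩(a,v,w,b)] - 1[T ∈ 𝒩(a,w,v,b)])`,
the sums over the spanning trees `T` of `G` (as edge sets, `spanningTreeEdgeSets`),
`wt(T) = Π_{f ∈ T} c(f)`, and `T ∈ 𝒩(a,v,w,b)` iff the `a`–`b` path of `T` passes along `vw` from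
`v` to `w`, i.e. `vw ∈ T` and in `T - vw` the vertex `a` is joined to `v` and `b` to `w`. In words:
the unit current flow is the expected net number of signed traversals of `vw` by the path from
`a` to `b` in the weighted uniform spanning tree. Proof: Grimmett's 2-forest ("bush") potential
is a voltage (`networkLaplacian_twoForestPotential`), voltages are unique up to constants on the
component (uniqueness principle), and the bush–tree correspondence.
[cite: Grimmett2018, §1.2, Theorem 1.16 and eq. (1.18)] -/
theorem unitCurrentFlow_mul_treeSum (hconn : G.Connected) (hpos : ∀ e ∈ G.edgeSet, 0 < c e)
    (a b v w : V) :
    unitCurrentFlow G c a b v w * ∑ T ∈ spanningTreeEdgeSets G, ∏ f ∈ T, (c f : ℝ) =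
      ∑ T ∈ spanningTreeEdgeSets G,
        ((if s(v, w) ∈ T ∧ (fromEdgeSet (T.erase s(v, w) : Set (Sym2 V))).Reachable a v ∧
              (fromEdgeSet (T.erase s(v, w) : Set (Sym2 V))).Reachable b w
            then ∏ f ∈ T, (c f : ℝ) else 0) -
          (if s(v, w) ∈ T ∧ (fromEdgeSet (T.erase s(v, w) : Set (Sym2 V))).Reachable b v ∧
              (fromEdgeSet (T.erase s(v, w) : Set (Sym2 V))).Reachable a w
            then ∏ f ∈ T, (c f : ℝ) else 0)) := by
  have hH : conductanceGraph G c = G := conductanceGraph_eq_of_pos hpos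
  have hreach : ∀ x y : V, (conductanceGraph G c).Reachable x y := fun x y ↦ by
    rw [hH]
    exact hconn.preconnected x y
  by_cases hadj : G.Adj v w
  swap
  · -- no tree contains the non-edge `vw`
    rw [unitCurrentFlow_of_not_adj hadj, zero_mul]
    refine (Finset.sum_eq_zero fun T hT ↦ ?_).symm
    have hvw : s(v, w) ∉ T := fun h ↦ hadj ((mem_edgeSet G).1
      (mem_edgeFinset.1 ((mem_spanningTreeEdgeSets_iff.1 hT).1 h)))
    simp [hvw]
  set N : V → ℝ := fun z ↦ ∑ F ∈ twoForestEdgeSets G a b,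
    if (fromEdgeSet (F : Set (Sym2 V))).Reachable a z then ∏ f ∈ F, (c f : ℝ) else 0 with hN
  set Tw : ℝ := ∑ T ∈ spanningTreeEdgeSets G, ∏ f ∈ T, (c f : ℝ) with hTw
  obtain ⟨φ, hφ, -, -⟩ := exists_networkLaplacian_eq G c (hreach a b)
  -- `N - Tw φ` has zero Laplacian, hence equal values across the edge `vw`
  have hL : ∀ z, networkLaplacian G c (fun y ↦ N y - Tw * φ y) z = 0 := fun z ↦ by
    rw [networkLaplacian_sub, networkLaplacian_smul, hφ, hN, networkLaplacian_twoForestPotential,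
      ← hTw, sub_self]
  have hvw : N v - Tw * φ v = N w - Tw * φ w :=
    eq_of_networkLaplacian_eq_zero G c hL (show (conductanceGraph G c).Adj v w from
      ⟨hadj, hpos _ ((mem_edgeSet G).2 hadj)⟩)
  -- so `c(vw) (N v - N w) = Tw · i(v, w)`
  rw [← conductance_mul_twoForestPotential_sub G c a b v w hadj,
    unitCurrentFlow_eq_of_networkLaplacian G c (hreach v b) hφ, if_pos hadj]
  change (c s(v, w) : ℝ) * (φ v - φ w) * Tw = (c s(v, w) : ℝ) * (N v - N w)
  have : N v - N w = Tw * (φ v - φ w) := by linarith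
  rw [this]
  ring

open Classical in
/-- **Kirchhoff's theorem**, ratio form (Grimmett 2018, Theorem 1.16 with (1.18):
`i_{v,w} = [N*(a,v,w,b) - N*(a,w,v,b)] / N*`): on a finite connected network with positive
conductances the tree sum `N* = Σ_T wt(T)` is positive and
`i(v, w) = Σ_T wt(T) (1[T ∈ 𝒩(a,v,w,b)] - 1[T ∈ 𝒩(a,w,v,b)]) / Σ_T wt(T)`.
[cite: Grimmett2018, §1.2, Theorem 1.16 and eq. (1.18)] -/
theorem unitCurrentFlow_eq_treeSum_div (hconn : G.Connected) (hpos : ∀ e ∈ G.edgeSet, 0 < c e)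
    (a b v w : V) :
    unitCurrentFlow G c a b v w =
      (∑ T ∈ spanningTreeEdgeSets G,
        ((if s(v, w) ∈ T ∧ (fromEdgeSet (T.erase s(v, w) : Set (Sym2 V))).Reachable a v ∧
              (fromEdgeSet (T.erase s(v, w) : Set (Sym2 V))).Reachable b w
            then ∏ f ∈ T, (c f : ℝ) else 0) -
          (if s(v, w) ∈ T ∧ (fromEdgeSet (T.erase s(v, w) : Set (Sym2 V))).Reachable b v ∧
              (fromEdgeSet (T.erase s(v, w) : Set (Sym2 V))).Reachable a w
            then ∏ f ∈ T, (c f : ℝ) else 0))) /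
        ∑ T ∈ spanningTreeEdgeSets G, ∏ f ∈ T, (c f : ℝ) := by
  -- the tree sum is positive: a spanning tree exists and all weights are positive
  have hwT : ∀ T ∈ spanningTreeEdgeSets G, (0 : ℝ) < ∏ f ∈ T, (c f : ℝ) := fun T hT ↦
    Finset.prod_pos fun f hf ↦ NNReal.coe_pos.2
      (hpos f (mem_edgeFinset.1 ((mem_spanningTreeEdgeSets_iff.1 hT).1 hf)))
  obtain ⟨T₀, hT₀G, hT₀⟩ := hconn.exists_isTree_le
  have hS : (Set.toFinite T₀.edgeSet).toFinset ∈ spanningTreeEdgeSets G := by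
    refine mem_spanningTreeEdgeSets_iff.2 ⟨fun e he ↦ ?_, ?_⟩
    · exact mem_edgeFinset.2 (edgeSet_mono hT₀G ((Set.Finite.mem_toFinset _).1 he))
    · rw [Set.Finite.coe_toFinset, fromEdgeSet_edgeSet]
      exact hT₀
  have hTpos : (0 : ℝ) < ∑ T ∈ spanningTreeEdgeSets G, ∏ f ∈ T, (c f : ℝ) :=
    Finset.sum_pos hwT ⟨_, hS⟩
  rw [eq_div_iff hTpos.ne', unitCurrentFlow_mul_treeSum G c hconn hpos]

end Kirchhoff

end

end Literature.Probability.LatticeModels
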